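import Literature.NumberTheory.Sieve.LevelOfDistribution
import Literature.NumberTheory.Sieve.MoebiusCoprimeProgressions
import Literature.NumberTheory.Sieve.BombieriFriedlanderIwaniecBoxes
import HarnessLib

/-!
# Discrepancy algebra for the Type II pieces of Proposition 2.7 (`GEH ⟹ EH`)

Trunk AntSieve, tooling toward the named fact `Literature.NumberTheory.Sieve.weakDHL_three_two_of_GEH`
(D. H. J. Polymath, Res. Math. Sci. 1:12 (2014) = arXiv:1407.4897, Theorem 3.2(xii)).  Generic
bookkeeping for the progression discrepancy `Δ(γ; a (q)) = apDiscrepancy γ N q a` of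
`LevelOfDistribution.lean`, used to cut the Type II term of Vaughan's identity into pieces to which
Claim 2.6 (`GeneralizedElliottHalberstam`) applies (Proposition 2.7, "Vaughan's identity and dyadic
decomposition", p. 7):

* linearity in `γ` (`apDiscrepancy_add/neg/sub/sum/smul`), dependence on `γ` only through its values
  on `[1, N]` (`apDiscrepancy_congr`), insensitivity of the cut-off beyond the support
  (`apDiscrepancy_eq_of_support`);
* the window discrepancy `Δ(γ 1_{(N', N]}) = Δ(γ; N) − Δ(γ; N')` (`apDiscrepancy_indicator_Ioc`);
* the STRADDLE bound (`abs_apDiscrepancy_le_of_abs_le`): if `|γ| ≤ G` pointwise then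
  `|Δ(γ; a (q))| ≤ Δ(G; a (q)) + (2/φ(q)) Σ_{n ≤ N} G(n)` — a piece whose range straddles the window
  is replaced by its nonnegative majorant `G = |α| ⋆ β`, to which `GEH` applies again, at the cost of
  an `ℓ¹` term;
* with the tree's `BFI.absAF α = |α|` (`BombieriFriedlanderIwaniecBoxes.lean`), `|(α ⋆ β)(n)| ≤ (|α| ⋆ β)(n)` for `β ≥ 0`
  (`abs_mul_apply_le_absAF_mul`), and `Σ_{n ≤ N} (|α| ⋆ β)(n) ≤ ‖α‖₁ ‖β‖₁` (`sum_Icc_absAF_mul_le`).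

## References

* [Polymath8b2014] D. H. J. Polymath, Res. Math. Sci. 1 (2014), Art. 12 = arXiv:1407.4897,
  Claim 2.6, Proposition 2.7 (pp. 6–7).
-/

noncomputable section

open Finset Real

namespace Literature.NumberTheory.Sieve

open BFI (absAF absAF_apply)

variable {q : ℕ}

/-! ### Linearity and locality of `apDiscrepancy` -/

/-- `Δ` is additive in the sequence. [folklore] -/
theorem apDiscrepancy_add (γ₁ γ₂ : ℕ → ℝ) (N : ℕ) (q : ℕ) (a : (ZMod q)ˣ) :
    apDiscrepancy (fun n => γ₁ n + γ₂ n) N q a = apDiscrepancy γ₁ N q a + apDiscrepancy γ₂ N q a := by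
  unfold apDiscrepancy
  rw [Finset.sum_add_distrib, Finset.sum_add_distrib]
  ring

/-- `Δ` commutes with negation. [folklore] -/
theorem apDiscrepancy_neg (γ : ℕ → ℝ) (N : ℕ) (q : ℕ) (a : (ZMod q)ˣ) :
    apDiscrepancy (fun n => -γ n) N q a = -apDiscrepancy γ N q a := by
  unfold apDiscrepancy
  rw [Finset.sum_neg_distrib, Finset.sum_neg_distrib]
  ring

/-- `Δ` is subtractive in the sequence. [folklore] -/
theorem apDiscrepancy_sub (γ₁ γ₂ : ℕ → ℝ) (N : ℕ) (q : ℕ) (a : (ZMod q)ˣ) :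
    apDiscrepancy (fun n => γ₁ n - γ₂ n) N q a = apDiscrepancy γ₁ N q a - apDiscrepancy γ₂ N q a := by
  unfold apDiscrepancy
  rw [Finset.sum_sub_distrib, Finset.sum_sub_distrib]
  ring

/-- `Δ` is homogeneous in the sequence. [folklore] -/
theorem apDiscrepancy_smul (c : ℝ) (γ : ℕ → ℝ) (N : ℕ) (q : ℕ) (a : (ZMod q)ˣ) :
    apDiscrepancy (fun n => c * γ n) N q a = c * apDiscrepancy γ N q a := by
  unfold apDiscrepancy
  rw [← Finset.mul_sum, ← Finset.mul_sum]
  ring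

/-- `Δ` of a finite sum of sequences. [folklore] -/
theorem apDiscrepancy_sum {ι : Type*} (s : Finset ι) (γ : ι → ℕ → ℝ) (N : ℕ) (q : ℕ) (a : (ZMod q)ˣ) :
    apDiscrepancy (fun n => ∑ i ∈ s, γ i n) N q a = ∑ i ∈ s, apDiscrepancy (γ i) N q a := by
  classical
  induction s using Finset.induction_on with
  | empty =>
    simp only [Finset.sum_empty]
    unfold apDiscrepancy
    simp
  | insert i s hi ih =>
    rw [Finset.sum_insert hi, ← ih, ← apDiscrepancy_add]
    congr 1
    funext n
    rw [Finset.sum_insert hi]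

/-- `Δ(γ; N)` depends only on the values of `γ` on `[1, N]`. [folklore] -/
theorem apDiscrepancy_congr {γ₁ γ₂ : ℕ → ℝ} {N : ℕ} (h : ∀ n ∈ Icc 1 N, γ₁ n = γ₂ n) (q : ℕ)
    (a : (ZMod q)ˣ) : apDiscrepancy γ₁ N q a = apDiscrepancy γ₂ N q a := by
  unfold apDiscrepancy
  rw [Finset.sum_congr rfl fun n hn => h n (Finset.mem_filter.1 hn).1,
    Finset.sum_congr rfl fun n hn => h n (Finset.mem_filter.1 hn).1]

/-- The zero sequence has zero discrepancy. [folklore] -/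
theorem apDiscrepancy_zero (N : ℕ) (q : ℕ) (a : (ZMod q)ˣ) : apDiscrepancy (fun _ => (0 : ℝ)) N q a = 0 := by
  unfold apDiscrepancy; simp

/-- **Cut-off beyond the support**: if `γ` vanishes on `(N, ∞)` then `Δ(γ; N') = Δ(γ; N)` for every
`N' ≥ N`. [folklore] -/
theorem apDiscrepancy_eq_of_support {γ : ℕ → ℝ} {N N' : ℕ} (hγ : ∀ n, N < n → γ n = 0) (hN : N ≤ N')
    (q : ℕ) (a : (ZMod q)ˣ) : apDiscrepancy γ N' q a = apDiscrepancy γ N q a := by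
  unfold apDiscrepancy
  have key : ∀ (p : ℕ → Prop) [DecidablePred p],
      ∑ n ∈ (Icc 1 N').filter p, γ n = ∑ n ∈ (Icc 1 N).filter p, γ n := by
    intro p _
    symm
    refine Finset.sum_subset (Finset.filter_subset_filter p (Finset.Icc_subset_Icc_right hN)) ?_
    intro n hn hn'
    have hp := (Finset.mem_filter.1 hn).2
    have h1 := (Finset.mem_filter.1 hn).1
    rw [Finset.mem_Icc] at h1
    have : n ∉ Icc 1 N := fun h => hn' (Finset.mem_filter.2 ⟨h, hp⟩)
    rw [Finset.mem_Icc] at this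
    exact hγ n (by omega)
  rw [key, key]

/-- **Window discrepancy**: `Δ(γ 1_{(N', N]}; N) = Δ(γ; N) − Δ(γ; N')` for `N' ≤ N`. [folklore] -/
theorem apDiscrepancy_indicator_Ioc {γ : ℕ → ℝ} {N N' : ℕ} (hN : N' ≤ N) (q : ℕ) (a : (ZMod q)ˣ) :
    apDiscrepancy (fun n => if N' < n then γ n else 0) N q a = apDiscrepancy γ N q a - apDiscrepancy γ N' q a := by
  have hsplit : ∀ (p : ℕ → Prop) [DecidablePred p],
      ∑ n ∈ (Icc 1 N).filter p, (if N' < n then γ n else 0) =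
        ∑ n ∈ (Icc 1 N).filter p, γ n - ∑ n ∈ (Icc 1 N').filter p, γ n := by
    intro p _
    have hsub : (Icc 1 N').filter p ⊆ (Icc 1 N).filter p :=
      Finset.filter_subset_filter p (Finset.Icc_subset_Icc_right hN)
    rw [← Finset.sum_sdiff hsub, ← Finset.sum_sdiff hsub]
    have e1 : ∑ n ∈ (Icc 1 N).filter p \ (Icc 1 N').filter p, (if N' < n then γ n else 0) =
        ∑ n ∈ (Icc 1 N).filter p \ (Icc 1 N').filter p, γ n := by
      refine Finset.sum_congr rfl fun n hn => ?_
      rw [Finset.mem_sdiff, Finset.mem_filter, Finset.mem_filter, Finset.mem_Icc, Finset.mem_Icc] at hn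
      rw [if_pos]
      by_contra h
      exact hn.2 ⟨⟨hn.1.1.1, not_lt.1 h⟩, hn.1.2⟩
    have e2 : ∑ n ∈ (Icc 1 N').filter p, (if N' < n then γ n else 0) = 0 := by
      refine Finset.sum_eq_zero fun n hn => ?_
      rw [Finset.mem_filter, Finset.mem_Icc] at hn
      rw [if_neg (by omega)]
    rw [e1, e2]
    ring
  unfold apDiscrepancy
  rw [hsplit, hsplit]
  ring

/-! ### The straddle bound -/

/-- **Straddle bound**: if `|γ(n)| ≤ G(n)` for all `n`, then for `q ≥ 1`
`|Δ(γ; a (q))| ≤ Δ(G; a (q)) + (2/φ(q)) Σ_{n ≤ N} G(n)`. [cite: Polymath8b2014, Proposition 2.7] -/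
theorem abs_apDiscrepancy_le_of_abs_le {γ G : ℕ → ℝ} (h : ∀ n, |γ n| ≤ G n) (N : ℕ) {q : ℕ}
    (hq : 1 ≤ q) (a : (ZMod q)ˣ) :
    |apDiscrepancy γ N q a| ≤ apDiscrepancy G N q a + 2 / (Nat.totient q : ℝ) * ∑ n ∈ Icc 1 N, G n := by
  have hφ0 : (0 : ℝ) < Nat.totient q := by exact_mod_cast Nat.totient_pos.2 (by omega)
  have hG0 : ∀ n, 0 ≤ G n := fun n => (abs_nonneg _).trans (h n)
  unfold apDiscrepancy
  set S₁ := ∑ n ∈ (Icc 1 N).filter (fun n : ℕ => (n : ZMod q) = a), γ n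
  set S₂ := ∑ n ∈ (Icc 1 N).filter (fun n : ℕ => n.Coprime q), γ n
  set T₁ := ∑ n ∈ (Icc 1 N).filter (fun n : ℕ => (n : ZMod q) = a), G n
  set T₂ := ∑ n ∈ (Icc 1 N).filter (fun n : ℕ => n.Coprime q), G n
  have h1 : |S₁| ≤ T₁ := (Finset.abs_sum_le_sum_abs _ _).trans (Finset.sum_le_sum fun n _ => h n)
  have h2 : |S₂| ≤ T₂ := (Finset.abs_sum_le_sum_abs _ _).trans (Finset.sum_le_sum fun n _ => h n)
  have h3 : T₂ ≤ ∑ n ∈ Icc 1 N, G n :=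
    Finset.sum_le_sum_of_subset_of_nonneg (Finset.filter_subset _ _) fun n _ _ => hG0 n
  have h4 : |S₁ - S₂ / Nat.totient q| ≤ |S₁| + |S₂| / Nat.totient q := by
    have := abs_sub S₁ (S₂ / Nat.totient q)
    rwa [abs_div, abs_of_pos hφ0] at this
  have h5 : |S₂| / Nat.totient q ≤ T₂ / Nat.totient q := div_le_div_of_nonneg_right h2 hφ0.le
  have h6 : T₂ / Nat.totient q ≤ (∑ n ∈ Icc 1 N, G n) / Nat.totient q := div_le_div_of_nonneg_right h3 hφ0.le
  have e : T₁ - T₂ / Nat.totient q + 2 / (Nat.totient q : ℝ) * ∑ n ∈ Icc 1 N, G n =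
      T₁ + T₂ / Nat.totient q + 2 * ((∑ n ∈ Icc 1 N, G n) / Nat.totient q - T₂ / Nat.totient q) := by
    ring
  rw [e]
  linarith

/-! ### Absolute values and `ℓ¹` norms of convolutions -/

/-- `|(α ⋆ β)(n)| ≤ (|α| ⋆ β)(n)` for `β ≥ 0`. [folklore] -/
theorem abs_mul_apply_le_absAF_mul (α β : ArithmeticFunction ℝ) (hβ : ∀ n, 0 ≤ β n) (n : ℕ) :
    |(α * β) n| ≤ (absAF α * β) n := by
  rw [ArithmeticFunction.mul_apply, ArithmeticFunction.mul_apply]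
  refine (Finset.abs_sum_le_sum_abs _ _).trans (Finset.sum_le_sum fun p _ => ?_)
  rw [abs_mul, absAF_apply, abs_of_nonneg (hβ _)]

/-- `(|α| ⋆ β)(n) ≥ 0` for `β ≥ 0`. [folklore] -/
theorem absAF_mul_nonneg (α β : ArithmeticFunction ℝ) (hβ : ∀ n, 0 ≤ β n) (n : ℕ) :
    0 ≤ (absAF α * β) n := by
  rw [ArithmeticFunction.mul_apply]
  exact Finset.sum_nonneg fun p _ => mul_nonneg (abs_nonneg _) (hβ _)

/-- **`ℓ¹` bound for a convolution**: for `f, g ≥ 0`,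
`Σ_{n ≤ N} (f ⋆ g)(n) ≤ (Σ_{m ≤ N} f(m)) (Σ_{c ≤ N} g(c))`. [folklore] -/
theorem sum_Icc_mul_le (f g : ArithmeticFunction ℝ) (hf : ∀ n, 0 ≤ f n) (hg : ∀ n, 0 ≤ g n) (N : ℕ) :
    ∑ n ∈ Icc 1 N, (f * g) n ≤ (∑ m ∈ Icc 1 N, f m) * ∑ c ∈ Icc 1 N, g c := by
  have h := sum_Icc_mul_dirichlet_eq f g (fun _ => (1 : ℝ)) N
  simp only [one_mul, mul_one] at h
  rw [h, Finset.sum_mul]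
  refine Finset.sum_le_sum fun t ht => ?_
  refine mul_le_mul_of_nonneg_left ?_ (hf t)
  refine Finset.sum_le_sum_of_subset_of_nonneg (Finset.Icc_subset_Icc_right (Nat.div_le_self N t)) ?_
  exact fun c _ _ => hg c

end Literature.NumberTheory.Sieve
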